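import Mathlib
import Literature.MathematicalPhysics.QuantumLattice.HubbardBandSectorCountingToolbox
import HarnessLib

/-!
# Route `KLProgramme` — crux K3 `KLRegimeTwoPointLimit` (stmt-HubbardSuperconductivity-19937), support:
# second-order non-degeneracy of the translated band Fermi curve at the `2k_F` caustic, and the
# square-root sublevel bound for strongly convex functions (DECOMP App. E Lemma E.3)

Cell `gate-hubbard-kl`, seat p1b (C1 second hand); paper note `HOME/prover-p1b/E1-NOTE.md` §3 Lemma 6
and the window part of the assembly.

At the caustic `w ∈ 2F_μ + 2πℤ²` the Fermi curve `F_μ` and its translate `F_μ + w` KISS (they are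
tangent from outside at `p = w/2`), the slope of the level function `G_w(θ) = ε(p_μ(θ) - w) - μ`
vanishes there, and the first-order transversality of `…ShellTransversality.lean` degenerates. What
saves the day (and produces the square-root cusp of `χ₀` at `2k_F` that MAKES the Kohn–Luttinger
coefficient) is STRICT CONVEXITY: the second derivative of `G_w` at the kissing configuration is
`2·Hess ε(p)(p', p') = 4(cos X·X'² + cos Y·Y'²) ≥ 4 h_min`. This file proves the quantitative version

  `G_w''(θ) ≥ 4 h_min - (4 s_max² + 4 A₂)·|2 p_μ(θ) - (w - 2πm)|_∞`     (`klsc_second_deriv_lower_bound`)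

for every `θ`, `w`, `m ∈ ℤ²` — no third derivative of the curve is needed, because the `p''`-term is
paired with `∇ε(p - w) ≈ -∇ε(p)` and the curve identity `Hess ε(p)(p',p') + ∇ε(p)·p'' = 0`
(`sin_mul_acc_eq_neg_hess`) turns it into a second copy of the Hessian term — together with the
derivative formula for `G_w'` (`klsc_hasDerivAt_transLevelDeriv`), and the abstract real-variable
consequence used on the caustic window:

  if `g'' ≥ c > 0` on `[x, y]` then `vol{z ∈ [x, y] : |g z| ≤ δ} ≤ 2s/c + 4δ/s` for every `s > 0`,
  hence `≤ 6 √(δ/c)`                                   (`klsc_volume_sublevel_le_of_convex[_sqrt]`),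

proved by a five-piece decomposition of the sublevel set into sets of small DIAMETER (`|g'| < s`:
diameter `≤ 2s/c` since `g'` grows at rate `c`; `|g'| ≥ s` with fixed signs of `g'` and `g`: diameter
`≤ δ/s` since `g` moves at rate `≥ s` inside a band of height `δ`) and `Real.volume_le_diam` — no
zero counting, no infima.

What is deliberately NOT here: the confinement of the near-tangent points to the caustic windows and
the zero count (E1-NOTE Lemma 7), the tube reduction and the final assembly of Lemma E.1/E.3.
-/

noncomputable section

-- the tree's namespace `Summit.<Summit>.<Problem>.Theorems` repeats the summit name by design (D-0017)
set_option linter.dupNamespace false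

open Real Set MeasureTheory
open scoped ENNReal
open Literature.MathematicalPhysics.QuantumLattice
open Literature.MathematicalPhysics.QuantumLattice.BandSectorCounting

namespace Summit.HubbardSuperconductivity.HubbardSuperconductivity.Theorems

/-! ### The second derivative of the translated level function -/

section Level

variable {μ : ℝ} (hμ₁ : -4 < μ) (hμ₂ : μ < 0)
include hμ₁ hμ₂

/-- The derivative of `G_w' = 2(sin(X - w₁)X' + sin(Y - w₂)Y')` is
`G_w'' = 2(cos(X - w₁)X'² + sin(X - w₁)X'' + cos(Y - w₂)Y'² + sin(Y - w₂)Y'')`. -/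
theorem klsc_hasDerivAt_transLevelDeriv (w₁ w₂ θ : ℝ) :
    HasDerivAt (fun t => 2 * (Real.sin (bandX μ t - w₁) * bandVX μ t + Real.sin (bandY μ t - w₂) * bandVY μ t))
      (2 * (Real.cos (bandX μ θ - w₁) * bandVX μ θ ^ 2 + Real.sin (bandX μ θ - w₁) * bandAX μ θ +
        Real.cos (bandY μ θ - w₂) * bandVY μ θ ^ 2 + Real.sin (bandY μ θ - w₂) * bandAY μ θ)) θ := by
  have hX := (hasDerivAt_bandX hμ₁ hμ₂ θ).sub_const w₁
  have hY := (hasDerivAt_bandY hμ₁ hμ₂ θ).sub_const w₂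
  have hVX := hasDerivAt_bandVX hμ₁ hμ₂ θ
  have hVY := hasDerivAt_bandVY hμ₁ hμ₂ θ
  have h := ((hX.sin.mul hVX).add (hY.sin.mul hVY)).const_mul (2 : ℝ)
  exact h.congr_deriv (by ring)

end Level

/-! ### Second-order non-degeneracy at the caustic -/

section Main

variable {a b : ℝ} (B : BandBounds a b) {μ : ℝ} (hμ : μ ∈ Icc a b)
include hμ

/-- **Second-order non-degeneracy of the translated curve.** For every `θ`, `w = (w₁, w₂)` and
`m = (m₀, m₁) ∈ ℤ²`, writing `Δ := 2 p_μ(θ) - (w - 2πm)` (the defect from the kissing configuration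
`w ≡ 2p_μ(θ)`), the second derivative of the translated level function satisfies
`G_w''(θ) ≥ 4 h_min - (4 s_max² + 4 A₂)·|Δ|_∞`. In particular on any arc where
`|Δ|_∞ ≤ h_min/(2 s_max² + 2 A₂)` the function `G_w` is `2h_min`-strongly convex. -/
theorem klsc_second_deriv_lower_bound (w₁ w₂ θ : ℝ) (m₀ m₁ : ℤ) :
    4 * B.hmin - (4 * B.smax ^ 2 + 4 * B.A2) *
        max |2 * bandX μ θ - (w₁ - m₀ * (2 * π))| |2 * bandY μ θ - (w₂ - m₁ * (2 * π))| ≤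
      2 * (Real.cos (bandX μ θ - w₁) * bandVX μ θ ^ 2 + Real.sin (bandX μ θ - w₁) * bandAX μ θ +
        Real.cos (bandY μ θ - w₂) * bandVY μ θ ^ 2 + Real.sin (bandY μ θ - w₂) * bandAY μ θ) := by
  obtain ⟨h1, h2⟩ := B.level hμ
  set X := bandX μ θ
  set Y := bandY μ θ
  set Δ₁ := 2 * X - (w₁ - m₀ * (2 * π)) with hΔ₁
  set Δ₂ := 2 * Y - (w₂ - m₁ * (2 * π)) with hΔ₂
  set D := max |Δ₁| |Δ₂| with hD
  -- rewrite the trigonometric factors around the kissing configuration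
  have hcx : Real.cos (X - w₁) = Real.cos (X - Δ₁) := by
    rw [show X - w₁ = (Δ₁ - X) - m₀ * (2 * π) by rw [hΔ₁]; ring, Real.cos_sub_int_mul_two_pi,
      ← Real.cos_neg, neg_sub]
  have hsx : Real.sin (X - w₁) = -Real.sin (X - Δ₁) := by
    rw [show X - w₁ = (Δ₁ - X) - m₀ * (2 * π) by rw [hΔ₁]; ring, Real.sin_sub_int_mul_two_pi,
      ← Real.sin_neg, neg_sub]
  have hcy : Real.cos (Y - w₂) = Real.cos (Y - Δ₂) := by
    rw [show Y - w₂ = (Δ₂ - Y) - m₁ * (2 * π) by rw [hΔ₂]; ring, Real.cos_sub_int_mul_two_pi,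
      ← Real.cos_neg, neg_sub]
  have hsy : Real.sin (Y - w₂) = -Real.sin (Y - Δ₂) := by
    rw [show Y - w₂ = (Δ₂ - Y) - m₁ * (2 * π) by rw [hΔ₂]; ring, Real.sin_sub_int_mul_two_pi,
      ← Real.sin_neg, neg_sub]
  -- the perturbations of the trigonometric factors are `≤ |Δ|`
  have ecx : |Real.cos (X - Δ₁) - Real.cos X| ≤ D :=
    ((Real.abs_cos_sub_cos_le _ _).trans (by rw [show X - Δ₁ - X = -Δ₁ by ring, abs_neg])).trans
      (le_max_left _ _)
  have esx : |Real.sin (X - Δ₁) - Real.sin X| ≤ D :=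
    ((Real.abs_sin_sub_sin_le _ _).trans (by rw [show X - Δ₁ - X = -Δ₁ by ring, abs_neg])).trans
      (le_max_left _ _)
  have ecy : |Real.cos (Y - Δ₂) - Real.cos Y| ≤ D :=
    ((Real.abs_cos_sub_cos_le _ _).trans (by rw [show Y - Δ₂ - Y = -Δ₂ by ring, abs_neg])).trans
      (le_max_right _ _)
  have esy : |Real.sin (Y - Δ₂) - Real.sin Y| ≤ D :=
    ((Real.abs_sin_sub_sin_le _ _).trans (by rw [show Y - Δ₂ - Y = -Δ₂ by ring, abs_neg])).trans
      (le_max_right _ _)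
  -- curve data bounds
  have hVX := B.abs_VX_le μ hμ θ
  have hVY := B.abs_VY_le μ hμ θ
  have hAX := B.abs_AX_le μ hμ θ
  have hAY := B.abs_AY_le μ hμ θ
  have hH := B.hess_ge μ hμ θ
  have hid := sin_mul_acc_eq_neg_hess h1 h2 θ
  have hD0 : 0 ≤ D := le_trans (abs_nonneg _) (le_max_left _ _)
  have hVX2 : bandVX μ θ ^ 2 ≤ B.smax ^ 2 := by
    rw [← sq_abs]; exact pow_le_pow_left₀ (abs_nonneg _) hVX 2
  have hVY2 : bandVY μ θ ^ 2 ≤ B.smax ^ 2 := by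
    rw [← sq_abs]; exact pow_le_pow_left₀ (abs_nonneg _) hVY 2
  -- the four error terms
  have e1 : |(Real.cos (X - Δ₁) - Real.cos X) * bandVX μ θ ^ 2| ≤ D * B.smax ^ 2 := by
    rw [abs_mul, abs_of_nonneg (sq_nonneg (bandVX μ θ))]
    exact mul_le_mul ecx hVX2 (sq_nonneg _) hD0
  have e2 : |(Real.sin (X - Δ₁) - Real.sin X) * bandAX μ θ| ≤ D * B.A2 := by
    rw [abs_mul]; exact mul_le_mul esx hAX (abs_nonneg _) hD0
  have e3 : |(Real.cos (Y - Δ₂) - Real.cos Y) * bandVY μ θ ^ 2| ≤ D * B.smax ^ 2 := by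
    rw [abs_mul, abs_of_nonneg (sq_nonneg (bandVY μ θ))]
    exact mul_le_mul ecy hVY2 (sq_nonneg _) hD0
  have e4 : |(Real.sin (Y - Δ₂) - Real.sin Y) * bandAY μ θ| ≤ D * B.A2 := by
    rw [abs_mul]; exact mul_le_mul esy hAY (abs_nonneg _) hD0
  have e1' := (abs_le.1 e1).1
  have e2' := (abs_le.1 e2).2
  have e3' := (abs_le.1 e3).1
  have e4' := (abs_le.1 e4).2
  -- assemble: the expression equals `2·(2H + errors)` with `H ≥ h_min`
  rw [hcx, hsx, hcy, hsy]
  have hexp : Real.cos (X - Δ₁) * bandVX μ θ ^ 2 + -Real.sin (X - Δ₁) * bandAX μ θ +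
      Real.cos (Y - Δ₂) * bandVY μ θ ^ 2 + -Real.sin (Y - Δ₂) * bandAY μ θ =
      2 * (Real.cos X * bandVX μ θ ^ 2 + Real.cos Y * bandVY μ θ ^ 2) +
        ((Real.cos (X - Δ₁) - Real.cos X) * bandVX μ θ ^ 2 -
          (Real.sin (X - Δ₁) - Real.sin X) * bandAX μ θ +
          (Real.cos (Y - Δ₂) - Real.cos Y) * bandVY μ θ ^ 2 -
          (Real.sin (Y - Δ₂) - Real.sin Y) * bandAY μ θ) := by
    linear_combination (-1 : ℝ) * hid
  rw [hexp]
  nlinarith [hH, e1', e2', e3', e4', hD0, B.smax_pos, B.A2_pos]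

end Main

/-! ### The square-root sublevel bound for strongly convex functions -/

/-- A set of reals any two of whose points (in increasing order) are within `d` has Lebesgue
measure `≤ d`. -/
theorem klsc_volume_le_of_forall_sub_le {S : Set ℝ} {d : ℝ}
    (h : ∀ z ∈ S, ∀ z' ∈ S, z ≤ z' → z' - z ≤ d) : volume S ≤ ENNReal.ofReal d := by
  refine (Real.volume_le_diam S).trans (Metric.ediam_le ?_)
  intro u hu v hv
  rw [edist_dist, Real.dist_eq]
  apply ENNReal.ofReal_le_ofReal
  rcases le_total u v with huv | hvu
  · rw [abs_of_nonpos (by linarith)]; linarith [h u hu v hv huv]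
  · rw [abs_of_nonneg (by linarith)]; linarith [h v hv u hu hvu]

/-- **Sublevel sets of strongly convex functions, two-parameter form.** If `g'' ≥ c > 0` on
`[x, y]` then for every `s > 0` (and every real `δ`),
`vol{z ∈ [x, y] : |g z| ≤ δ} ≤ 2s/c + 4·(δ/s)`: the points with `|g'| < s` form a set of diameter
`≤ 2s/c` (the slope grows at rate `c`), and the points with `|g'| ≥ s`, split by the signs of `g'`
and `g`, form four sets of diameter `≤ δ/s` each (`g` moves at rate `≥ s` inside a band of height
`δ`). -/
theorem klsc_volume_sublevel_le_of_convex {g g' g'' : ℝ → ℝ} (hg : ∀ t, HasDerivAt g (g' t) t)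
    (hg' : ∀ t, HasDerivAt g' (g'' t) t) {x y c δ s : ℝ} (hc : 0 < c) (hs : 0 < s)
    (hconv : ∀ t ∈ Icc x y, c ≤ g'' t) :
    volume {z ∈ Icc x y | |g z| ≤ δ} ≤ ENNReal.ofReal (2 * s / c) + 4 * ENNReal.ofReal (δ / s) := by
  -- monotonicity of the slope: `c (z' - z) ≤ g' z' - g' z`
  have hd' : ∀ t, HasDerivAt g' (deriv g' t) t := fun t => by rw [(hg' t).deriv]; exact hg' t
  have hdg : ∀ t, HasDerivAt g (deriv g t) t := fun t => by rw [(hg t).deriv]; exact hg t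
  have M1 : ∀ z ∈ Icc x y, ∀ z' ∈ Icc x y, z ≤ z' → c * (z' - z) ≤ g' z' - g' z := by
    intro z hz z' hz' hzz'
    exact (convex_Icc x y).mul_sub_le_image_sub_of_le_deriv
      (fun t _ => (hd' t).continuousAt.continuousWithinAt)
      (fun t _ => (hd' t).differentiableAt.differentiableWithinAt)
      (fun t ht => by rw [(hg' t).deriv]; exact hconv t (interior_subset ht)) z hz z' hz' hzz'
  -- `g` increases at rate `≥ s` to the right of a point with `g' ≥ s`
  have M2 : ∀ z ∈ Icc x y, ∀ z' ∈ Icc x y, z ≤ z' → s ≤ g' z → s * (z' - z) ≤ g z' - g z := by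
    intro z hz z' hz' hzz' hsz
    refine (convex_Icc z z').mul_sub_le_image_sub_of_le_deriv
      (fun t _ => (hdg t).continuousAt.continuousWithinAt)
      (fun t _ => (hdg t).differentiableAt.differentiableWithinAt)
      (fun t ht => ?_) z (left_mem_Icc.2 hzz') z' (right_mem_Icc.2 hzz') hzz'
    have ht' : t ∈ Icc z z' := interior_subset ht
    have htI : t ∈ Icc x y := ⟨le_trans hz.1 ht'.1, le_trans ht'.2 hz'.2⟩
    rw [(hg t).deriv]
    have := M1 z hz t htI ht'.1
    nlinarith [ht'.1]
  -- `g` decreases at rate `≥ s` to the left of a point with `g' ≤ -s`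
  have M3 : ∀ z ∈ Icc x y, ∀ z' ∈ Icc x y, z ≤ z' → g' z' ≤ -s → s * (z' - z) ≤ g z - g z' := by
    intro z hz z' hz' hzz' hsz
    have hder : ∀ t ∈ interior (Icc z z'), deriv g t ≤ -s := by
      intro t ht
      have ht' : t ∈ Icc z z' := interior_subset ht
      have htI : t ∈ Icc x y := ⟨le_trans hz.1 ht'.1, le_trans ht'.2 hz'.2⟩
      rw [(hg t).deriv]
      have := M1 t htI z' hz' ht'.2
      nlinarith [ht'.2]
    have h := (convex_Icc z z').image_sub_le_mul_sub_of_deriv_le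
      (fun t _ => (hdg t).continuousAt.continuousWithinAt)
      (fun t _ => (hdg t).differentiableAt.differentiableWithinAt)
      hder z (left_mem_Icc.2 hzz') z' (right_mem_Icc.2 hzz') hzz'
    linarith
  -- the five pieces
  set T := {z ∈ Icc x y | |g z| ≤ δ} with hT
  set P0 := {z ∈ Icc x y | |g' z| < s} with hP0
  set P1 := {z ∈ Icc x y | |g z| ≤ δ ∧ s ≤ g' z ∧ 0 ≤ g z} with hP1
  set P2 := {z ∈ Icc x y | |g z| ≤ δ ∧ s ≤ g' z ∧ g z ≤ 0} with hP2
  set P3 := {z ∈ Icc x y | |g z| ≤ δ ∧ g' z ≤ -s ∧ 0 ≤ g z} with hP3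
  set P4 := {z ∈ Icc x y | |g z| ≤ δ ∧ g' z ≤ -s ∧ g z ≤ 0} with hP4
  have hcover : T ⊆ (((P0 ∪ P1) ∪ P2) ∪ P3) ∪ P4 := by
    intro z hz
    obtain ⟨hzI, hgz⟩ := hz
    by_cases h0 : |g' z| < s
    · exact Or.inl (Or.inl (Or.inl (Or.inl ⟨hzI, h0⟩)))
    · push Not at h0
      rcases le_abs'.1 h0 with hneg | hpos
      · rcases le_total 0 (g z) with hg0 | hg0
        · exact Or.inl (Or.inr ⟨hzI, hgz, hneg, hg0⟩)
        · exact Or.inr ⟨hzI, hgz, hneg, hg0⟩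
      · rcases le_total 0 (g z) with hg0 | hg0
        · exact Or.inl (Or.inl (Or.inl (Or.inr ⟨hzI, hgz, hpos, hg0⟩)))
        · exact Or.inl (Or.inl (Or.inr ⟨hzI, hgz, hpos, hg0⟩))
  -- diameters
  have v0 : volume P0 ≤ ENNReal.ofReal (2 * s / c) := by
    refine klsc_volume_le_of_forall_sub_le (fun z hz z' hz' hzz' => ?_)
    have h := M1 z hz.1 z' hz'.1 hzz'
    have h1 := (abs_lt.1 hz.2).1
    have h2 := (abs_lt.1 hz'.2).2
    rw [le_div_iff₀ hc]; nlinarith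
  have v1 : volume P1 ≤ ENNReal.ofReal (δ / s) := by
    refine klsc_volume_le_of_forall_sub_le (fun z hz z' hz' hzz' => ?_)
    have h := M2 z hz.1 z' hz'.1 hzz' hz.2.2.1
    have h1 := (abs_le.1 hz'.2.1).2
    have h2 := hz.2.2.2
    rw [le_div_iff₀ hs]; nlinarith
  have v2 : volume P2 ≤ ENNReal.ofReal (δ / s) := by
    refine klsc_volume_le_of_forall_sub_le (fun z hz z' hz' hzz' => ?_)
    have h := M2 z hz.1 z' hz'.1 hzz' hz.2.2.1
    have h1 := hz'.2.2.2
    have h2 := (abs_le.1 hz.2.1).1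
    rw [le_div_iff₀ hs]; nlinarith
  have v3 : volume P3 ≤ ENNReal.ofReal (δ / s) := by
    refine klsc_volume_le_of_forall_sub_le (fun z hz z' hz' hzz' => ?_)
    have h := M3 z hz.1 z' hz'.1 hzz' hz'.2.2.1
    have h1 := (abs_le.1 hz.2.1).2
    have h2 := hz'.2.2.2
    rw [le_div_iff₀ hs]; nlinarith
  have v4 : volume P4 ≤ ENNReal.ofReal (δ / s) := by
    refine klsc_volume_le_of_forall_sub_le (fun z hz z' hz' hzz' => ?_)
    have h := M3 z hz.1 z' hz'.1 hzz' hz'.2.2.1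
    have h1 := hz.2.2.2
    have h2 := (abs_le.1 hz'.2.1).1
    rw [le_div_iff₀ hs]; nlinarith
  calc volume T ≤ volume ((((P0 ∪ P1) ∪ P2) ∪ P3) ∪ P4) := measure_mono hcover
    _ ≤ volume (((P0 ∪ P1) ∪ P2) ∪ P3) + volume P4 := measure_union_le _ _
    _ ≤ (volume ((P0 ∪ P1) ∪ P2) + volume P3) + volume P4 := by gcongr; exact measure_union_le _ _
    _ ≤ ((volume (P0 ∪ P1) + volume P2) + volume P3) + volume P4 := by
        gcongr; exact measure_union_le _ _
    _ ≤ (((volume P0 + volume P1) + volume P2) + volume P3) + volume P4 := by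
        gcongr; exact measure_union_le _ _
    _ ≤ (((ENNReal.ofReal (2 * s / c) + ENNReal.ofReal (δ / s)) + ENNReal.ofReal (δ / s)) +
          ENNReal.ofReal (δ / s)) + ENNReal.ofReal (δ / s) := by gcongr
    _ = ENNReal.ofReal (2 * s / c) + 4 * ENNReal.ofReal (δ / s) := by ring

/-- **The square-root sublevel bound.** If `g'' ≥ c > 0` on `[x, y]` and `δ > 0` then
`vol{z ∈ [x, y] : |g z| ≤ δ} ≤ 6 √(δ/c)` (take `s = c√(δ/c)` above). Applied on a caustic window with
`g = G_w`, `c = 2h_min` (`klsc_second_deriv_lower_bound`), this is the `ε₂^{1/2}` term of Lemma E.3 —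
the `2k_F` square-root gain of the particle–hole bubble. -/
theorem klsc_volume_sublevel_le_of_convex_sqrt {g g' g'' : ℝ → ℝ} (hg : ∀ t, HasDerivAt g (g' t) t)
    (hg' : ∀ t, HasDerivAt g' (g'' t) t) {x y c δ : ℝ} (hc : 0 < c) (hδ : 0 < δ)
    (hconv : ∀ t ∈ Icc x y, c ≤ g'' t) :
    volume {z ∈ Icc x y | |g z| ≤ δ} ≤ ENNReal.ofReal (6 * Real.sqrt (δ / c)) := by
  set q := Real.sqrt (δ / c) with hq
  have hq0 : 0 < q := Real.sqrt_pos.2 (div_pos hδ hc)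
  have hq2 : q ^ 2 = δ / c := Real.sq_sqrt (div_pos hδ hc).le
  have hs : 0 < c * q := mul_pos hc hq0
  have h := klsc_volume_sublevel_le_of_convex hg hg' (δ := δ) hc hs hconv
  have h1 : 2 * (c * q) / c = 2 * q := by field_simp
  have h2 : δ / (c * q) = q := by
    rw [div_eq_iff hs.ne']
    have : δ = c * q ^ 2 := by rw [hq2]; field_simp
    rw [this]; ring
  rw [h1, h2] at h
  refine h.trans (le_of_eq ?_)
  rw [show (4 : ℝ≥0∞) = ENNReal.ofReal 4 by norm_num, ← ENNReal.ofReal_mul (by norm_num),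
    ← ENNReal.ofReal_add (by linarith) (by linarith)]
  congr 1; ring

end Summit.HubbardSuperconductivity.HubbardSuperconductivity.Theorems

end
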